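import Literature.MathematicalPhysics.QuantumFieldTheory.Balaban1983to89.Node00.CarriersB8SubBP
import Literature.MathematicalPhysics.QuantumFieldTheory.Balaban1983to89.B8Thm8SurvivingZdGF3HP2MapLanEGamma
import Literature.MathematicalPhysics.QuantumFieldTheory.Balaban1983to89.B8Prop3SrcZd3HP2Gamma
import Literature.MathematicalPhysics.QuantumFieldTheory.Balaban1983to89.B8LanF146
import Literature.MathematicalPhysics.QuantumFieldTheory.Balaban1983to89.B8SockSP5UniformThresholdsSrcGammaPrime
import Literature.MathematicalPhysics.QuantumFieldTheory.Balaban1983to89.B8ConstraintBonds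
import Literature.MathematicalPhysics.QuantumFieldTheory.Balaban1983to89.Node00.CarriersB8SubD

/-!
# BalabanUVNodes ∕ N05 ([Balaban1985RegularSpaces] Thm 8 p. 101): THEOREM 8's CONJUNCT OF THE «P₂C» SLOT — `Thm8SurvivingAt 1 λ.B₁ λ.B₂ (zdGF3HP₂ ∘ ·.1.1.1)` on the
# COLLAR SUB-FAMILY `IdxB8SubD θ` of the four-law `Ω₀ = ℤᵈ` sub-index (print's (1.3)–(1.4) as typed), EDITION δ₂ (the Hölder member of
# (1.36) «on Ω_j»), FROM this seat's D7-3(C)₂ `B8Thm8SurvivingZdGF3HP2MapLanEGamma.thm8SurvivingAt_zdGF3HP₂_map_lanE_γ'` at `ι := (·.1.1.1)`, `LanF := LanF146`, `γ₈ ↦ 1`,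
# Proposition 3 with source PROVED INSIDE by D7-2b₂ `B8Prop3SrcZd3HP2Gamma.sp3src_zdGF3HP₂_map_of_sockB9P3srcHP₂_γ`; modulo the four Prop-5-type sourced sockets
# (γ′ letters) and the sourced b9 socket of Prop. 3's frame (Hölder line on Ω_j × Ω_j pairs), each at the COLLAR law members only — D9a₂C, PIN-FREE
# (the «P₂C» pin `Node00.CarriersB8SubBP2C.famB8OfRecordSubBP₂C θ β len j := zdGF3HP₂ θ.𝔸 θ.L β len j.1.1.1.1` reads this conclusion by `rfl`)

EDITION «P₂D» (dag-n05-d g12, 2026-08-28; dag-n05-w1 LOCATED-SLET ∕ p613168, dag-n05-c DESIGN WORD I.30865, dag-n05-w1 `Node00/CarriersB8SubD`): the «P₂C» file of the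
same name-stem RE-KEYED onto the (1.5)-obeying admissible sub-index `Node00.IdxB8SubD θ = {j : IdxB8SubC θ ∕∕ ∀ l < k, ∀ z ∈ Λs k l, Lˡ•z ∈ Lam θ.L Ω l}` — every
class-wide [Balaban1985BackgroundPropagators]-type binder (`SLet SLetUB SB9P SH59src SB9srcHP` and the produced Prop-5-type families) gains print's (1.5) layer law
«`∀ l, l < i.k → ∀ z ∈ i.Λs i.k l, ((θ.L : ℤ) ^ l) • z ∈ B8ConstraintBonds.Lam θ.L i.Ω l`» as ONE extra member hypothesis right after `DomainSeq θ.L i.Ω` (the member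
class of the «P₂C» binders admitted dag-n05-w1's all-`univ` datum `i⋆`, at which `SockLettersRD` is contradictory — p613168 `sLet_idxB8LawsB_unsatisfiable`; with (1.5)
conjoined `i⋆` is excluded, dag-n05-c p613464 `not_lamTop_allUniv`), and the leaf's members are the `IdxB8SubD` ones (accessors `j.1.1.1 ↦ j.1.1.1.1`, …, the new
`j.2` = the (1.5) law at the member).  Proposition 6's cube family (over `IdxB8SubB`) and the pinned axial map are unchanged.  Proof terms = the «P₂C» ones token for
token.  The rest of this header is the «P₂C» header VERBATIM (read `IdxB8SubD` ∕ the (1.5)-members for `{j : IdxB8SubB θ ∕∕ DomainSeq …}` ∕ the collar law members).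

Track A of `YM-PLAN.md` (cell `pub-ymgap`, HUMAN RULING D-0062), node **N05**; seat `pub-ymgap-dag-n05-d` (g11), 2026-08-28; bears on K1⁷ `stmt-QuantumFields-20542`
(`--supports … --as helper`, count-neutral).  THE STORY.  DESIGN «P₂C» (this seat, cell bus 03:12Z; dag-n05-w1 WORD-P₂C «YES + amendment (i): index on the EXISTING
`B8ConstraintBonds.DomainSeq`», 03:13Z; dag-n05-e ACK-4): NODE 00's [B8] slot is re-pinned ONCE for three located narrownesses — №4 the Hölder class of (1.36) ∕ (1.59)
(edition δ₂ of the carrier, this seat's `B8LeafModelZd3P2`, p599986), the (1.4) collar law as an INDEX law (the admissible sub-family `DomainSeq θ.L ·.Ω`, dag-n05-w2's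
`B8Prop7TowerAxialAdmissible`), and Proposition 7's currency (`B8LeafKnitRSC.B8LeafRSC`, this seat's p602607).  THIS FILE is D9a (p594062 ∕ p595709) RE-RUN on that
sub-family and carrier, token for token by `gen_d9a2c.py` on the tree bytes: the index `IdxB8SubB θ` ↦ the subtype (one more `.1` in every accessor), the family
`famB8OfRecordSubBP θ λ.β λ.len j = zdGF3HP … j.1.1.1` ↦ `zdGF3HP₂ θ.𝔸 θ.L λ.β λ.len j.1.1.1.1`, the socket binders demanded at `i.Ω 0 = univ ∧ IdxB8LawsB θ.L i ∧ DomainSeq θ.L i.Ω`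
members only (N06 serves FEWER members), the sourced Prop-3-frame socket's Hölder line over the both-points class, the callees D7-2b₂ ∕ D7-3(C)₂.

WHAT IS PROVED (composition BY NAME; no estimate; no new definition):
* ★★ **`t8P₂D_of_socketsSrc_γ'`** — `B8Thm8Surviving.Thm8SurvivingAt 1 λ.B₁ λ.B₂ (fun j : {j : IdxB8SubB θ ∕∕ DomainSeq θ.L j.1.1.1.Ω} => zdGF3HP₂ θ.𝔸 θ.L λ.β λ.len j.1.1.1.1)`
  from Theorem 8's constants `cP cu cP3 γ₈ γ′ γ″ γβ B₈ B₈β` with the layer equations and guards (D9a's, verbatim) and the five sourced sockets at the collar law members.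
* ★★ **`t8P₂D_of_lettersSrc_γ'`** — the same with the four Prop-5-type sockets SERVED from [4]'s letters `SLet SLetUB` + `SH59src` at the collar law members by dag-n05-w4's
  member-uniform thresholds (`exists_uniform_threshold_sp5{base,,u}_src_γ'`, unchanged — they are per member).
HONEST FRAMING: kernel bookkeeping by name; the sockets are HYPOTHESES ([Balaban1985BackgroundPropagators]-type statements with source at collar law members; N06 content,
`m ≥ 1` OPEN; NOT claimed); ONE conjunct of the «P₂C» slot, not the slot; count-neutral; **N05 NOT discharged**; Bałaban AS PRINTED with locators; constants sufficient, not
optimal; one finite 𝕋⁴ programme at fixed ε; nothing continuum ∕ ℝ⁴ ∕ OS ∕ mass-gap ∕ Clay.  No `sorry`, no new definition.  Unit `pub-ymgap-dag-n05-d` (g11), 2026-08-28.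
[cite: Balaban1985RegularSpaces, Thm 8 (1.146) p.101, Thm 4 p.88, Prop. 3 p.87, Prop. 5 (1.106)–(1.110) p.94, (1.3)–(1.4) p.77, (1.31) p.82, (1.35)–(1.36) p.82, (1.59)–(1.62) pp.86–87; Balaban1985BackgroundPropagators, Thm 3.1 p.397, Thm 3.3 p.398, (3.40) p.397]
-/

noncomputable section

namespace Summit.QuantumFields.YangMills.BalabanUVNodes.N05SubBP2DT8SrvGammaPrime

open Literature.MathematicalPhysics.QuantumFieldTheory.Balaban1983to89
open Literature.MathematicalPhysics.QuantumFieldTheory.Balaban1983to89.Node00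
open Literature.MathematicalPhysics.QuantumFieldTheory.Balaban1983to89.B8IdxB8LawsB (IdxB8LawsB IdxB8SubB)
open Literature.MathematicalPhysics.QuantumFieldTheory.Balaban1983to89.B8LeafModelZd (ZdIdx)
open Literature.MathematicalPhysics.QuantumFieldTheory.Balaban1983to89.B8LeafModelZd3P (zdGF3HP)
open Literature.MathematicalPhysics.QuantumFieldTheory.Balaban1983to89.B8LeafModelZd3P2 (zdGF3HP₂)
open Literature.MathematicalPhysics.QuantumFieldTheory.Balaban1983to89.B8TowerBondsPrinted (towerBondsP)
open Literature.MathematicalPhysics.QuantumFieldTheory.Balaban1983to89.B8Lemma1NonAbelian (mulCfg)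
open Literature.MathematicalPhysics.QuantumFieldTheory.Balaban1983to89.B8Thm8SurvivingZdGF3HP2MapLanEGamma (thm8SurvivingAt_zdGF3HP₂_map_lanE_γ')
open Literature.MathematicalPhysics.QuantumFieldTheory.Balaban1983to89.B8Prop3SrcZd3HP2Gamma (sp3src_zdGF3HP₂_map_of_sockB9P3srcHP₂_γ)
open Literature.MathematicalPhysics.QuantumFieldTheory.Balaban1983to89.B8LanF146 (LanF146 lanF146_top_iff)
open Literature.MathematicalPhysics.QuantumFieldTheory.Balaban1983to89.B8SockLettersRD (SockLettersRD)
open Literature.MathematicalPhysics.QuantumFieldTheory.Balaban1983to89.B8SockSP5UniformThresholdsSrcGammaPrime (exists_uniform_threshold_sp5_src_γ' exists_uniform_threshold_sp5base_src_γ' exists_uniform_threshold_sp5u_src_γ')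
open B7Eq78Linearization (zdBlocking QprimeIter)
open B8Eq119TwistedAxial (bgT)
open B8Eq138LandauZd (QT)
open B8Eq1117Concrete (XSpace)
open B8Prop5ContractionKLevel (Bd2)
open B8LambdaSpaceKLevel (wt)
open MatrixLog B7Prop1Explicit B7Prop2Explicit B7Prop1Local B7Eq92Concrete
open B8Ineq130 (tlo thi)
open B8Ineq132 (InAk covDerivFwd)
open B8Eq119TwistedAxial (Restr129 InAx)
open B8Eq140Level (SideTouches)
open B8Eq138LandauZd (covLap InR138 IsLandau146W)
open B8Eq184Proof (gaugeExp cfgExp)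
open B8Eq146AExpansion (iEta plaqCovDeriv)
open B8Eq143PlaqExpansion (pdiv)
open B7Prop4GeneralLevels (linCovIter)
open B8Eq155JBound (Jcur wsup)
open B8ScaledSupNorm (bondNorm msup Bdd)
open B9Eq340HolderZd (hquot AdmPair)

-- `Site` alone could resolve to the torus sites of `Setup.lean`; re-export the `ℤ^d` sites of `B7Prop1Explicit`.
export B7Prop1Explicit (Site)

section T8P

/-- ★★ **(EDITION δ₂, COLLAR SUB-FAMILY) THEOREM 8's CONJUNCT OF THE «P₂C» SLOT — `Thm8SurvivingAt 1 λ.B₁ λ.B₂ (zdGF3HP₂ ∘ ·.1.1.1)` on `IdxB8SubD θ` — FROM THE γ′ THEOREM-8 KNIT ON `zdGF3HP₂`, SOCKETS DISPLAYED AT THE COLLAR LAW MEMBERS (`i.Ω 0 = univ ∧ IdxB8LawsB θ.L i ∧ DomainSeq θ.L i.Ω`; the sourced Prop-3-frame socket's Hölder line on Ω_j × Ω_j pairs)**; the rest of this docstring is D9a's VERBATIM (read `zdGF3HP₂` for `zdGF3HP` ∕ `famB8OfRecordSubBP`, `sp3src_zdGF3HP₂_…` ∕ `thm8SurvivingAt_zdGF3HP₂_…`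 for the callees): — for the record's `θ` (`D ≥ 2`) and residual layer `λ` with
Theorem 8's constants as in p521275 (`cP, cu` for the Prop-5-type sockets, `cP3` for Prop. 3's b9 socket, `γ₈ ≥ 1`, `γ′, γ″ ≥ 0`, `γβ`, `B₈ ≥ λ.inp.B₀`, `B₈β`, with
`5dL·B₀ + 2γ′B₀ ≤ 5dL·B₈`, `5dL·B₀ + 2γ″B₀ ≤ 5dL·B₈`, `5dL·B₀β + 2B₀β·γ″B₀ + γβ ≤ 5dL·B₈β`, `λ.B₁ = 5dL·B₈·(1+11d²)`, `λ.B₂ = 5dL·B₈β·(1+11d²)`): IF at every `Ω₀ = ℤᵈ`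
law member `i` the four sourced sockets of Theorem 4's frame at (1.146) hold in the γ′ letters below `cP` (`SP5base`, `SP5`, `SH59src`, `SP5u`) and the sourced b9 socket of
Proposition 3's frame holds below `cP3` (`SB9srcHP`), THEN Theorem 8 in its surviving form at `γ = 1` holds on the P-sub-family of record:
`Thm8SurvivingAt 1 λ.B₁ λ.B₂ (famB8OfRecordSubBP θ λ.β λ.len)` — the `t8` conjunct of `b8LeafOfRecordSubBP_iff_classFree_and_P`.  Proof: `SP3src` by
`sp3src_zdGF3HP_map_of_sockB9P3srcHP_γ` at `ι := (·.1.1)`; `thm8SurvivingAt_zdGF3HP_map_lanE_γ'` at `ι := (·.1.1)`, `hΩ0 := (·.1.2)`, `htw := IdxB8SubB.tower_all`,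
`LanF := LanF146` (`hLanF := lanF146_top_iff`); `γ₈ ↦ 1` by `thm8SurvivingAt_anti`; the family is `famB8OfRecordSubBP` by `rfl`.
[cite: Balaban1985RegularSpaces, Thm 8 (1.146) p.101, Thm 4 p.88, Prop. 3 p.87, Prop. 5 p.94, (1.31) p.82, (1.35) p.82, (1.59)–(1.62) pp.86–87, p.77; Balaban1985BackgroundPropagators, Thm 3.3 p.398] -/
theorem t8P₂D_of_socketsSrc_γ' {θ : Stage3Params} (lam : ResidB8 θ) (hD : 2 ≤ θ.D)
    {cP cu cP3 γ₈ γ' γ'' γβ B₈ B₈β : ℝ} (hcP : 0 < cP) (hcu : 0 < cu) (hcP3 : 0 < cP3) (hγ₈ : 1 ≤ γ₈) (hγ' : 0 ≤ γ') (hγ'' : 0 ≤ γ'')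
    (hB : 2 ≤ 5 * (θ.D : ℝ) * θ.L * lam.inp.B₀) (hB₀β : 0 < lam.B₀β) (hB₀8 : lam.inp.B₀ ≤ B₈)
    (hγB : 5 * (θ.D : ℝ) * θ.L * lam.inp.B₀ + 2 * (γ' * lam.inp.B₀) ≤ 5 * (θ.D : ℝ) * θ.L * B₈)
    (hγB'' : 5 * (θ.D : ℝ) * θ.L * lam.inp.B₀ + 2 * (γ'' * lam.inp.B₀) ≤ 5 * (θ.D : ℝ) * θ.L * B₈)
    (hB8β : 5 * (θ.D : ℝ) * θ.L * lam.B₀β + 2 * lam.B₀β * (γ'' * lam.inp.B₀) + γβ ≤ 5 * (θ.D : ℝ) * θ.L * B₈β)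
    (hB₁eq : lam.B₁ = 5 * (θ.D : ℝ) * θ.L * B₈ * (1 + 11 * (θ.D : ℝ) ^ 2)) (hB₂eq : lam.B₂ = 5 * (θ.D : ℝ) * θ.L * B₈β * (1 + 11 * (θ.D : ℝ) ^ 2))
    -- THE FOUR SOURCED SOCKETS OF THEOREM 4's FRAME AT (1.146), γ′ LETTERS (one-end-point (1.35) antecedent; `|B₁|` over print's class `towerBondsP`), at the `Ω₀ = ℤᵈ` LAW
    -- MEMBERS ONLY, below ONE threshold `cP` (Prop. 5 ∃ base ∕ step with source, [4] Thm 3.3 with source, Prop. 5 ! with source) — HYPOTHESES (providers: dag-n05-w4 γ′ chain)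
    (SP5base : ∀ i : ZdIdx θ.D θ.L, i.Ω 0 = Set.univ → IdxB8LawsB θ.L i → B8ConstraintBonds.DomainSeq θ.L i.Ω → (∀ l, l < i.k → ∀ z ∈ i.Λs i.k l, ((θ.L : ℤ) ^ l) • z ∈ B8ConstraintBonds.Lam θ.L i.Ω l) → ∀ α₀ α₁ : ℝ, 0 < α₀ → 0 < α₁ → α₀ + α₁ ≤ cP →
      ∀ U₀ U' : Site θ.D → Fin θ.D → θ.𝔸ˣ, (∀ x κ, U₀ x κ ∈ unitaryUnits θ.𝔸) → (∀ x κ, U' x κ ∈ unitaryUnits θ.𝔸) →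
      ∀ φ : Site θ.D → θ.𝔸, ((InR138 θ.L i.k i.η (i.Ω 0) (i.Λs i.k) U₀ φ ∧ (∀ x, IsSelfAdjoint (φ x)) ∧ (∀ x, x ∉ i.Ω 0 → φ x = 0) ∧
          Bdd θ.L i.k i.η (-(2 : ℝ)) (fun j (x : Site θ.D) => x ∈ i.Ω j) φ) ∧
        msup θ.L i.k i.η (-(2 : ℝ)) (fun j (x : Site θ.D) => x ∈ i.Ω j) φ < γ₈ * (α₀ + α₁)) →
      InAk θ.L i.k i.η α₀ i.Ω U₀ → InAk θ.L i.k i.η α₀ i.Ω (mulCfg U' U₀) → (∀ m, m ≤ i.k → InAx θ.L m (i.Λs m) U₀ (mulCfg U' U₀)) →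
      (∀ j, j ≤ i.k → ∀ (z : Site θ.D) (μ : Fin θ.D),
        ((∀ x, InBox (tlo θ.L z j) (thi θ.L z j) x → x ∈ i.Ω j) ∨ (∀ x, InBox (tlo θ.L (z + e μ) j) (thi θ.L (z + e μ) j) x → x ∈ i.Ω j)) →
        ‖(avgIter θ.L (mulCfg U' U₀) j z μ : θ.𝔸) - (avgIter θ.L U₀ j z μ : θ.𝔸)‖ ≤ α₁) →
      (∀ b ∈ {b : Site θ.D × Fin θ.D | SideTouches (i.Ω 0) b.1 b.2}, ‖((U' b.1 b.2 : θ.𝔸ˣ) : θ.𝔸) - 1‖ ≤ α₁) →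
      (∃ (v : Site θ.D → θ.𝔸ˣ) (la : Site θ.D → θ.𝔸), (∀ x, v x ∈ unitaryUnits θ.𝔸) ∧ (∀ x, x ∉ i.Ω 0 → v x = 1) ∧
        (∀ j, j ≤ 1 → ∀ b ∈ {b : Site θ.D × Fin θ.D | SideTouches (i.Ω j) b.1 b.2}, (v b.1 : θ.𝔸) = ((gaugeExp la b.1 : θ.𝔸ˣ) : θ.𝔸) ∧
        (v (b.1 + e b.2) : θ.𝔸) = ((gaugeExp la (b.1 + e b.2) : θ.𝔸ˣ) : θ.𝔸)) ∧
        (∀ j, j ≤ 1 → ∀ b ∈ {b : Site θ.D × Fin θ.D | SideTouches (i.Ω j) b.1 b.2},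
        ‖la b.1‖ ≤ (8 * lam.inp.B₀' * (5 * (θ.D : ℝ) * θ.L * B₈) * (α₀ + α₁)) ∧ ((θ.L : ℝ) ^ j * i.η) * ‖covDerivFwd i.η U₀ b.2 la b.1‖ ≤ (8 * lam.inp.B₀' * (5 * (θ.D : ℝ) * θ.L * B₈) * (α₀ + α₁))) ∧
        LanF146 θ.L i.k i.η (i.Ω 0) i.Λs U₀ φ 1 (mgauge U₀ v⁻¹ U') ∧ Restr129 θ.L 1 (i.Λs 1) U₀ ((1 : Site θ.D → θ.𝔸ˣ) * v)))
    (SP5 : ∀ i : ZdIdx θ.D θ.L, i.Ω 0 = Set.univ → IdxB8LawsB θ.L i → B8ConstraintBonds.DomainSeq θ.L i.Ω → (∀ l, l < i.k → ∀ z ∈ i.Λs i.k l, ((θ.L : ℤ) ^ l) • z ∈ B8ConstraintBonds.Lam θ.L i.Ω l) → ∀ α₀ α₁ : ℝ, 0 < α₀ → 0 < α₁ → α₀ + α₁ ≤ cP →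
      ∀ U₀ U' : Site θ.D → Fin θ.D → θ.𝔸ˣ, (∀ x κ, U₀ x κ ∈ unitaryUnits θ.𝔸) → (∀ x κ, U' x κ ∈ unitaryUnits θ.𝔸) →
      ∀ φ : Site θ.D → θ.𝔸, ((InR138 θ.L i.k i.η (i.Ω 0) (i.Λs i.k) U₀ φ ∧ (∀ x, IsSelfAdjoint (φ x)) ∧ (∀ x, x ∉ i.Ω 0 → φ x = 0) ∧
          Bdd θ.L i.k i.η (-(2 : ℝ)) (fun j (x : Site θ.D) => x ∈ i.Ω j) φ) ∧
        msup θ.L i.k i.η (-(2 : ℝ)) (fun j (x : Site θ.D) => x ∈ i.Ω j) φ < γ₈ * (α₀ + α₁)) →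
      InAk θ.L i.k i.η α₀ i.Ω U₀ → InAk θ.L i.k i.η α₀ i.Ω (mulCfg U' U₀) → (∀ m, m ≤ i.k → InAx θ.L m (i.Λs m) U₀ (mulCfg U' U₀)) →
      (∀ j, j ≤ i.k → ∀ (z : Site θ.D) (μ : Fin θ.D),
        ((∀ x, InBox (tlo θ.L z j) (thi θ.L z j) x → x ∈ i.Ω j) ∨ (∀ x, InBox (tlo θ.L (z + e μ) j) (thi θ.L (z + e μ) j) x → x ∈ i.Ω j)) →
        ‖(avgIter θ.L (mulCfg U' U₀) j z μ : θ.𝔸) - (avgIter θ.L U₀ j z μ : θ.𝔸)‖ ≤ α₁) →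
      (∀ b ∈ {b : Site θ.D × Fin θ.D | SideTouches (i.Ω 0) b.1 b.2}, ‖((U' b.1 b.2 : θ.𝔸ˣ) : θ.𝔸) - 1‖ ≤ α₁) →
      (∀ m, 1 ≤ m → m < i.k → ∀ (u₁ : Site θ.D → θ.𝔸ˣ) (U₁ : Site θ.D → Fin θ.D → θ.𝔸ˣ) (A : Site θ.D → Fin θ.D → θ.𝔸),
        (∀ x, u₁ x ∈ unitaryUnits θ.𝔸) → (∀ x, x ∉ i.Ω 0 → u₁ x = 1) → mgauge U₀ u₁ U₁ = U' → Restr129 θ.L m (i.Λs m) U₀ u₁ →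
        LanF146 θ.L i.k i.η (i.Ω 0) i.Λs U₀ φ m U₁ →
        (∀ j, j ≤ m → ∀ b ∈ {b : Site θ.D × Fin θ.D | SideTouches (i.Ω j) b.1 b.2},
        U₁ b.1 b.2 = cfgExp i.η A b.1 b.2 ∧ IsSelfAdjoint (A b.1 b.2) ∧ ‖A b.1 b.2‖ ≤ (5 * (θ.D : ℝ) * θ.L * B₈ * (α₀ + α₁)) * ((θ.L : ℝ) ^ j * i.η)⁻¹) →
        ∃ (v : Site θ.D → θ.𝔸ˣ) (la : Site θ.D → θ.𝔸), (∀ x, v x ∈ unitaryUnits θ.𝔸) ∧ (∀ x, x ∉ i.Ω 0 → v x = 1) ∧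
        (∀ j, j ≤ m + 1 → ∀ b ∈ {b : Site θ.D × Fin θ.D | SideTouches (i.Ω j) b.1 b.2}, (v b.1 : θ.𝔸) = ((gaugeExp la b.1 : θ.𝔸ˣ) : θ.𝔸) ∧
        (v (b.1 + e b.2) : θ.𝔸) = ((gaugeExp la (b.1 + e b.2) : θ.𝔸ˣ) : θ.𝔸)) ∧
        (∀ j, j ≤ m + 1 → ∀ b ∈ {b : Site θ.D × Fin θ.D | SideTouches (i.Ω j) b.1 b.2},
        ‖la b.1‖ ≤ (8 * lam.inp.B₀' * (5 * (θ.D : ℝ) * θ.L * B₈) * (α₀ + α₁)) ∧ ((θ.L : ℝ) ^ j * i.η) * ‖covDerivFwd i.η U₀ b.2 la b.1‖ ≤ (8 * lam.inp.B₀' * (5 * (θ.D : ℝ) * θ.L * B₈) * (α₀ + α₁))) ∧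
        LanF146 θ.L i.k i.η (i.Ω 0) i.Λs U₀ φ (m + 1) (mgauge U₀ v⁻¹ U₁) ∧ Restr129 θ.L (m + 1) (i.Λs (m + 1)) U₀ (u₁ * v)))
    (SH59src : ∀ i : ZdIdx θ.D θ.L, i.Ω 0 = Set.univ → IdxB8LawsB θ.L i → B8ConstraintBonds.DomainSeq θ.L i.Ω → (∀ l, l < i.k → ∀ z ∈ i.Λs i.k l, ((θ.L : ℤ) ^ l) • z ∈ B8ConstraintBonds.Lam θ.L i.Ω l) → ∀ α₀ α₁ : ℝ, 0 < α₀ → 0 < α₁ → α₀ + α₁ ≤ cP →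
      ∀ U₀ U' : Site θ.D → Fin θ.D → θ.𝔸ˣ, (∀ x κ, U₀ x κ ∈ unitaryUnits θ.𝔸) → (∀ x κ, U' x κ ∈ unitaryUnits θ.𝔸) →
      ∀ φ : Site θ.D → θ.𝔸, ((InR138 θ.L i.k i.η (i.Ω 0) (i.Λs i.k) U₀ φ ∧ (∀ x, IsSelfAdjoint (φ x)) ∧ (∀ x, x ∉ i.Ω 0 → φ x = 0) ∧
          Bdd θ.L i.k i.η (-(2 : ℝ)) (fun j (x : Site θ.D) => x ∈ i.Ω j) φ) ∧
        msup θ.L i.k i.η (-(2 : ℝ)) (fun j (x : Site θ.D) => x ∈ i.Ω j) φ < γ₈ * (α₀ + α₁)) →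
      InAk θ.L i.k i.η α₀ i.Ω U₀ → InAk θ.L i.k i.η α₀ i.Ω (mulCfg U' U₀) → (∀ m, m ≤ i.k → InAx θ.L m (i.Λs m) U₀ (mulCfg U' U₀)) →
      (∀ j, j ≤ i.k → ∀ (z : Site θ.D) (μ : Fin θ.D),
        ((∀ x, InBox (tlo θ.L z j) (thi θ.L z j) x → x ∈ i.Ω j) ∨ (∀ x, InBox (tlo θ.L (z + e μ) j) (thi θ.L (z + e μ) j) x → x ∈ i.Ω j)) →
        ‖(avgIter θ.L (mulCfg U' U₀) j z μ : θ.𝔸) - (avgIter θ.L U₀ j z μ : θ.𝔸)‖ ≤ α₁) →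
      (∀ b ∈ {b : Site θ.D × Fin θ.D | SideTouches (i.Ω 0) b.1 b.2}, ‖((U' b.1 b.2 : θ.𝔸ˣ) : θ.𝔸) - 1‖ ≤ α₁) →
      (∀ m, 1 ≤ m → m ≤ i.k → ∀ (u : Site θ.D → θ.𝔸ˣ) (W : Site θ.D → Fin θ.D → θ.𝔸ˣ) (A' : Site θ.D → Fin θ.D → θ.𝔸),
        (∀ x, u x ∈ unitaryUnits θ.𝔸) → mgauge U₀ u W = U' → Restr129 θ.L m (i.Λs m) U₀ u → LanF146 θ.L i.k i.η (i.Ω 0) i.Λs U₀ φ m W →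
        (∀ y τ, IsSelfAdjoint (A' y τ)) →
        (∀ j, j ≤ m → ∀ y τ, SideTouches (i.Ω j) y τ →
        W y τ = cfgExp i.η A' y τ ∧ ‖A' y τ‖ ≤ (2 * (θ.L * (5 * (θ.D : ℝ) * θ.L * B₈ * (α₀ + α₁))) + 8 * (8 * lam.inp.B₀' * (5 * (θ.D : ℝ) * θ.L * B₈) * (α₀ + α₁))) * ((θ.L : ℝ) ^ j * i.η)⁻¹) →
        (∀ y τ, (∀ j, j ≤ m → ¬ SideTouches (i.Ω j) y τ) → A' y τ = 0) →
        msup θ.L m i.η (-(1 : ℝ)) (fun j (b : Site θ.D × Fin θ.D) => SideTouches (i.Ω j) b.1 b.2) (fun b => A' b.1 b.2)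
        ≤ lam.inp.B₀ * (bondNorm θ.L m i.η (-(3 : ℝ)) i.Ω (fun x μ => Jcur i.η U₀ A' μ x)
        + wsup 1 (fun p : {p : ℕ × (Site θ.D × Fin θ.D) // p.1 ≤ m ∧ p.2 ∈ towerBondsP θ.L i.Ω (i.Λs m) p.1} =>
        linCovIter θ.L U₀ (iEta i.η A') p.1.1 p.1.2.1 p.1.2.2)) + γ' * lam.inp.B₀ * (α₀ + α₁) ∧
        msup θ.L m i.η (-(2 : ℝ)) (fun j (t : Fin θ.D × Fin θ.D × Site θ.D) => SideTouches (i.Ω j) t.2.2 t.2.1)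
        (fun t => covDerivFwd i.η U₀ t.1 (fun z => A' z t.2.1) t.2.2)
        ≤ lam.inp.B₀ * (bondNorm θ.L m i.η (-(3 : ℝ)) i.Ω (fun x μ => Jcur i.η U₀ A' μ x)
        + wsup 1 (fun p : {p : ℕ × (Site θ.D × Fin θ.D) // p.1 ≤ m ∧ p.2 ∈ towerBondsP θ.L i.Ω (i.Λs m) p.1} =>
        linCovIter θ.L U₀ (iEta i.η A') p.1.1 p.1.2.1 p.1.2.2)) + γ' * lam.inp.B₀ * (α₀ + α₁)))
    (SP5u : ∀ i : ZdIdx θ.D θ.L, i.Ω 0 = Set.univ → IdxB8LawsB θ.L i → B8ConstraintBonds.DomainSeq θ.L i.Ω → (∀ l, l < i.k → ∀ z ∈ i.Λs i.k l, ((θ.L : ℤ) ^ l) • z ∈ B8ConstraintBonds.Lam θ.L i.Ω l) → ∀ α₀ α₁ : ℝ, 0 < α₀ → 0 < α₁ → α₀ + α₁ ≤ cP →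
      ∀ U₀ U' : Site θ.D → Fin θ.D → θ.𝔸ˣ, (∀ x κ, U₀ x κ ∈ unitaryUnits θ.𝔸) → (∀ x κ, U' x κ ∈ unitaryUnits θ.𝔸) →
      ∀ φ : Site θ.D → θ.𝔸, ((InR138 θ.L i.k i.η (i.Ω 0) (i.Λs i.k) U₀ φ ∧ (∀ x, IsSelfAdjoint (φ x)) ∧ (∀ x, x ∉ i.Ω 0 → φ x = 0) ∧
          Bdd θ.L i.k i.η (-(2 : ℝ)) (fun j (x : Site θ.D) => x ∈ i.Ω j) φ) ∧
        msup θ.L i.k i.η (-(2 : ℝ)) (fun j (x : Site θ.D) => x ∈ i.Ω j) φ < γ₈ * (α₀ + α₁)) →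
      InAk θ.L i.k i.η α₀ i.Ω U₀ → InAk θ.L i.k i.η α₀ i.Ω (mulCfg U' U₀) → (∀ m, m ≤ i.k → InAx θ.L m (i.Λs m) U₀ (mulCfg U' U₀)) →
      (∀ j, j ≤ i.k → ∀ (z : Site θ.D) (μ : Fin θ.D),
        ((∀ x, InBox (tlo θ.L z j) (thi θ.L z j) x → x ∈ i.Ω j) ∨ (∀ x, InBox (tlo θ.L (z + e μ) j) (thi θ.L (z + e μ) j) x → x ∈ i.Ω j)) →
        ‖(avgIter θ.L (mulCfg U' U₀) j z μ : θ.𝔸) - (avgIter θ.L U₀ j z μ : θ.𝔸)‖ ≤ α₁) →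
      (∀ b ∈ {b : Site θ.D × Fin θ.D | SideTouches (i.Ω 0) b.1 b.2}, ‖((U' b.1 b.2 : θ.𝔸ˣ) : θ.𝔸) - 1‖ ≤ α₁) →
      ∀ u₁ : Site θ.D → θ.𝔸ˣ, (∀ x, u₁ x ∈ unitaryUnits θ.𝔸) → (∀ x, x ∉ i.Ω 0 → u₁ x = 1) → Restr129 θ.L i.k (i.Λs i.k) U₀ u₁ →
      LanF146 θ.L i.k i.η (i.Ω 0) i.Λs U₀ φ i.k (mgauge U₀ u₁⁻¹ U') →
      (∃ A₁ : Site θ.D → Fin θ.D → θ.𝔸, ∀ j, j ≤ i.k → ∀ (x : Site θ.D) (κ : Fin θ.D), SideTouches (i.Ω j) x κ →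
        mgauge U₀ u₁⁻¹ U' x κ = cfgExp i.η A₁ x κ ∧ ‖A₁ x κ‖ ≤ (5 * (θ.D : ℝ) * θ.L * B₈ * (α₀ + α₁)) * ((θ.L : ℝ) ^ j * i.η)⁻¹) →
      ∀ (v w : Site θ.D → θ.𝔸ˣ) (la mu : Site θ.D → θ.𝔸),
      (∀ x, ((gaugeExp la x : θ.𝔸ˣ) : θ.𝔸) = ((v x : θ.𝔸ˣ) : θ.𝔸) ∧ IsSelfAdjoint (la x) ∧ ‖la x‖ < cu) → (∀ x, x ∉ i.Ω 0 → la x = 0) →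
      (∀ j, j ≤ i.k → ∀ b ∈ {b : Site θ.D × Fin θ.D | SideTouches (i.Ω j) b.1 b.2}, ((θ.L : ℝ) ^ j * i.η) * ‖covDerivFwd i.η U₀ b.2 la b.1‖ < cu) →
      (∀ x, ((gaugeExp mu x : θ.𝔸ˣ) : θ.𝔸) = ((w x : θ.𝔸ˣ) : θ.𝔸) ∧ IsSelfAdjoint (mu x) ∧ ‖mu x‖ < cu) → (∀ x, x ∉ i.Ω 0 → mu x = 0) →
      (∀ j, j ≤ i.k → ∀ b ∈ {b : Site θ.D × Fin θ.D | SideTouches (i.Ω j) b.1 b.2}, ((θ.L : ℝ) ^ j * i.η) * ‖covDerivFwd i.η U₀ b.2 mu b.1‖ < cu) →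
      LanF146 θ.L i.k i.η (i.Ω 0) i.Λs U₀ φ i.k (mgauge U₀ v⁻¹ (mgauge U₀ u₁⁻¹ U')) → Restr129 θ.L i.k (i.Λs i.k) U₀ (u₁ * v) →
      LanF146 θ.L i.k i.η (i.Ω 0) i.Λs U₀ φ i.k (mgauge U₀ w⁻¹ (mgauge U₀ u₁⁻¹ U')) → Restr129 θ.L i.k (i.Λs i.k) U₀ (u₁ * w) →
      ∀ x, v x = w x)
    -- THE SOURCED b9 SOCKET OF PROPOSITION 3's FRAME at the `Ω₀ = ℤᵈ` law members, threshold `cP3`, `|B₁|` over print's class at the top truncation — HYPOTHESIS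
    -- ([Balaban1985BackgroundPropagators] Thm 3.3 with source; = `B8Prop3SrcZd3HPGamma`'s input letter for letter)
    (SB9srcHP : ∀ i : ZdIdx θ.D θ.L, i.Ω 0 = Set.univ → IdxB8LawsB θ.L i → B8ConstraintBonds.DomainSeq θ.L i.Ω → (∀ l, l < i.k → ∀ z ∈ i.Λs i.k l, ((θ.L : ℤ) ^ l) • z ∈ B8ConstraintBonds.Lam θ.L i.Ω l) → ∀ α₀ α₁ α₂ : ℝ, 0 < α₀ → α₀ ≤ cP3 → 0 < α₁ → 0 < α₂ → α₂ ≤ cP3 →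
      ∀ (U₀ W : Site θ.D → Fin θ.D → θ.𝔸ˣ), (∀ x κ, U₀ x κ ∈ unitaryUnits θ.𝔸) → (∀ x κ, W x κ ∈ unitaryUnits θ.𝔸) →
      ∀ f : Site θ.D → θ.𝔸, InR138 θ.L i.k i.η (i.Ω 0) (i.Λs i.k) U₀ f →
      (∀ x, IsSelfAdjoint (f x)) → (∀ x, x ∉ i.Ω 0 → f x = 0) →
      Bdd θ.L i.k i.η (-(2 : ℝ)) (fun j (x : Site θ.D) => x ∈ i.Ω j) f →
      msup θ.L i.k i.η (-(2 : ℝ)) (fun j (x : Site θ.D) => x ∈ i.Ω j) f < γ₈ * (α₀ + α₁) →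
      msup θ.L i.k i.η (-(3 : ℝ)) (fun j (p : Fin θ.D × Site θ.D) => p.2 ∈ i.Ω j) (fun p => covDerivFwd i.η U₀ p.1 f p.2) < γ₈ * (α₀ + α₁) →
      InAk θ.L i.k i.η α₀ i.Ω U₀ → InAk θ.L i.k i.η α₀ i.Ω (mulCfg W U₀) → IsLandau146W θ.L i.k i.η (i.Ω 0) (i.Λs i.k) U₀ f W →
      ∀ A' : Site θ.D → Fin θ.D → θ.𝔸, (∀ y τ, IsSelfAdjoint (A' y τ)) →
      (∀ j, j ≤ i.k → ∀ (y : Site θ.D) (τ : Fin θ.D), SideTouches (i.Ω j) y τ →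
        W y τ = cfgExp i.η A' y τ ∧ ‖A' y τ‖ ≤ α₂ * ((θ.L : ℝ) ^ j * i.η)⁻¹) →
      (∀ (y : Site θ.D) (τ : Fin θ.D), (∀ j, j ≤ i.k → ¬ SideTouches (i.Ω j) y τ) → A' y τ = 0) →
      msup θ.L i.k i.η (-(1 : ℝ)) (fun j (b : Site θ.D × Fin θ.D) => SideTouches (i.Ω j) b.1 b.2) (fun b => A' b.1 b.2)
          ≤ lam.inp.B₀ * (bondNorm θ.L i.k i.η (-(3 : ℝ)) i.Ω (fun x μ => Jcur i.η U₀ A' μ x)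
            + wsup 1 (fun p : {p : ℕ × (Site θ.D × Fin θ.D) // p.1 ≤ i.k ∧ p.2 ∈ towerBondsP θ.L i.Ω (i.Λs i.k) p.1} =>
                linCovIter θ.L U₀ (iEta i.η A') p.1.1 p.1.2.1 p.1.2.2)) + γ'' * lam.inp.B₀ * (α₀ + α₁) ∧
        msup θ.L i.k i.η (-(2 : ℝ)) (fun j (t : Fin θ.D × Fin θ.D × Site θ.D) => SideTouches (i.Ω j) t.2.2 t.2.1)
            (fun t => covDerivFwd i.η U₀ t.1 (fun z => A' z t.2.1) t.2.2)
          ≤ lam.inp.B₀ * (bondNorm θ.L i.k i.η (-(3 : ℝ)) i.Ω (fun x μ => Jcur i.η U₀ A' μ x)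
            + wsup 1 (fun p : {p : ℕ × (Site θ.D × Fin θ.D) // p.1 ≤ i.k ∧ p.2 ∈ towerBondsP θ.L i.Ω (i.Λs i.k) p.1} =>
                linCovIter θ.L U₀ (iEta i.η A') p.1.1 p.1.2.1 p.1.2.2)) + γ'' * lam.inp.B₀ * (α₀ + α₁) ∧
        bondNorm θ.L i.k i.η (-(3 : ℝ)) i.Ω (fun x μ => pdiv i.η U₀ (plaqCovDeriv i.η U₀ A') μ x)
          ≤ lam.inp.B₀ * (bondNorm θ.L i.k i.η (-(3 : ℝ)) i.Ω (fun x μ => Jcur i.η U₀ A' μ x)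
            + wsup 1 (fun p : {p : ℕ × (Site θ.D × Fin θ.D) // p.1 ≤ i.k ∧ p.2 ∈ towerBondsP θ.L i.Ω (i.Λs i.k) p.1} =>
                linCovIter θ.L U₀ (iEta i.η A') p.1.1 p.1.2.1 p.1.2.2)) + γ'' * lam.inp.B₀ * (α₀ + α₁) ∧
        bondNorm θ.L i.k i.η (-(3 : ℝ)) i.Ω (fun x μ => covLap i.η U₀ (fun z => A' z μ) x)
          ≤ lam.inp.B₀ * (bondNorm θ.L i.k i.η (-(3 : ℝ)) i.Ω (fun x μ => Jcur i.η U₀ A' μ x)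
            + wsup 1 (fun p : {p : ℕ × (Site θ.D × Fin θ.D) // p.1 ≤ i.k ∧ p.2 ∈ towerBondsP θ.L i.Ω (i.Λs i.k) p.1} =>
                linCovIter θ.L U₀ (iEta i.η A') p.1.1 p.1.2.1 p.1.2.2)) + γ'' * lam.inp.B₀ * (α₀ + α₁) ∧
        msup θ.L i.k i.η (-(2 + lam.β)) (fun j (q : Fin θ.D × Fin θ.D × (Site θ.D × Site θ.D)) => q.2.2 ∈ AdmPair i.η lam.len ∧ q.2.2.1 ∈ i.Ω j ∧ q.2.2.2 ∈ i.Ω j)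
            (fun q => hquot i.η lam.β lam.len U₀ (covDerivFwd i.η U₀ q.1 (fun z => A' z q.2.1)) q.2.2)
          ≤ lam.B₀β * (bondNorm θ.L i.k i.η (-(3 : ℝ)) i.Ω (fun x μ => Jcur i.η U₀ A' μ x)
            + wsup 1 (fun p : {p : ℕ × (Site θ.D × Fin θ.D) // p.1 ≤ i.k ∧ p.2 ∈ towerBondsP θ.L i.Ω (i.Λs i.k) p.1} =>
                linCovIter θ.L U₀ (iEta i.η A') p.1.1 p.1.2.1 p.1.2.2)) + γβ * (α₀ + α₁)) :
    B8Thm8Surviving.Thm8SurvivingAt 1 lam.B₁ lam.B₂ (fun j : IdxB8SubD θ => zdGF3HP₂ θ.𝔸 θ.L lam.β lam.len j.1.1.1.1) := by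
  -- constants: `0 < B₀ ≤ B₈`, `2 ≤ 5dLB₀ ≤ 5dLB₈`
  have hB₀ : 0 < lam.inp.B₀ := lam.inp.B₀_pos
  have hB₈ : 0 < B₈ := lt_of_lt_of_le hB₀ hB₀8
  have h5 : 0 ≤ 5 * (θ.D : ℝ) * θ.L := by positivity
  have hB8' : 2 ≤ 5 * (θ.D : ℝ) * θ.L * B₈ := hB.trans (mul_le_mul_of_nonneg_left hB₀8 h5)
  -- PROPOSITION 3 WITH SOURCE on the P-carrier at the law members from the sourced b9 socket in Prop. 3's frame (D7-2b): `SP3src` at `ι := j ↦ j.1.1.1`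
  obtain ⟨cP3', hcP3', SP3src⟩ := sp3src_zdGF3HP₂_map_of_sockB9P3srcHP₂_γ (𝔸 := θ.𝔸) (γ := γ₈) hD θ.two_le_L hB₀ hB₀β.le hcP3 hγ'' hγB'' hB8β lam.β lam.len
    (fun j : IdxB8SubD θ => j.1.1.1.1) (fun j => SB9srcHP j.1.1.1.1 j.1.1.1.2 j.1.1.2 j.1.2 j.2)
  -- THEOREM 8 (surviving) on the P-carrier at the law members: D7-3(C) at `ι := (·.1.1)`, `LanF := LanF146`, tower law at every truncation from the sub-index, then `γ₈ ↦ 1`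
  have t8γ := thm8SurvivingAt_zdGF3HP₂_map_lanE_γ' (𝔸 := θ.𝔸) (β := lam.β) (len := lam.len) hD θ.two_le_L hB₀ lam.inp.B₀'_pos hcu hcP hcP3'
    (lt_of_lt_of_le one_pos hγ₈) hγ' hB₈ hB₀8 hB8' hγB (fun j : IdxB8SubD θ => j.1.1.1.1) (fun j => j.1.1.1.2) (fun j => IdxB8SubB.tower_all j.1.1)
    (fun j U₀ f m W => LanF146 θ.L j.1.1.1.1.k j.1.1.1.1.η (j.1.1.1.1.Ω 0) j.1.1.1.1.Λs U₀ f m W)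
    (fun j U₀ f W => lanF146_top_iff θ.L j.1.1.1.1.k j.1.1.1.1.η (j.1.1.1.1.Ω 0) j.1.1.1.1.Λs U₀ f W)
    (fun j => SP5base j.1.1.1.1 j.1.1.1.2 j.1.1.2 j.1.2 j.2) (fun j => SP5 j.1.1.1.1 j.1.1.1.2 j.1.1.2 j.1.2 j.2) (fun j => SH59src j.1.1.1.1 j.1.1.1.2 j.1.1.2 j.1.2 j.2) (fun j => SP5u j.1.1.1.1 j.1.1.1.2 j.1.1.2 j.1.2 j.2) SP3src
  rw [hB₁eq, hB₂eq]
  exact B8Thm8Surviving.thm8SurvivingAt_anti _ hγ₈ t8γ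

/-- ★★ **(EDITION δ₂, COLLAR SUB-FAMILY) THE SAME WITH THE PROP-5-TYPE SOCKETS SERVED FROM [4]'s LETTERS AT THE COLLAR LAW MEMBERS**; the rest of this docstring is D9a's VERBATIM: (p521275's Theorem-8 paragraph, re-keyed to the P-slot):
the same conclusion `Thm8SurvivingAt 1 λ.B₁ λ.B₂ (famB8OfRecordSubBP θ λ.β λ.len)` from: [4]'s letters at the `Ω₀ = ℤᵈ` law members (existence side, RD currency:
`SLet`; uniqueness side, left-inverse law of `G′` on bounded functions: `SLetUB`), the sourced free-constant guard `3·(2dL²)·B_G·B_R·(B₈ + γ₈) ≤ B₀′·B₈`, Theorem 8's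
constants and layer equations as above, and the TWO sourced b9 sockets — `SH59src` ([4] Thm 3.3 with source in Theorem 4's frame at (1.146), γ′ letter, threshold `c59`,
`|B₁|` over print's class `towerBondsP L i.Ω (i.Λs m) ·`) and `SB9srcHP` (Prop. 3's frame, threshold `cP3`) — each at the law members ONLY.  INSIDE: `SP5base` ∕ `SP5` ∕
`SP5u` in the γ′ letters below ONE member-uniform threshold by dag-n05-w4's `B8SockSP5UniformThresholdsSrcGammaPrime.exists_uniform_threshold_sp5{base,,u}_src_γ'`
(inputs: the letters, `SH59src`, the member's `ZdIdx` laws, the class laws of PRINT's class `B8TowerBondsPrinted.ZdIdx.towerBondsP_laws` — box law «box ⊂ Ω_{j−1}» and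
membership trichotomy —, the truncation tower law `IdxB8Laws.tower_all`, №8 `trunc_lt` ∕ `trunc_top`); then `t8P_famB8OfRecordSubBP_of_socketsSrc_γ'` at
`cP := min c59 (min cPb (min cP5 cPu))`.
[cite: Balaban1985RegularSpaces, Thm 8 (1.146) p.101, Prop. 5 (1.106)–(1.110) p.94 («c₂, c₃ depending on d and L only»), Thm 4 p.88, Prop. 3 p.87, (1.31) p.82, (1.35) p.82, p.77; Balaban1985BackgroundPropagators, Thm 3.1 p.397, Thm 3.3 p.398] -/
theorem t8P₂D_of_lettersSrc_γ' {θ : Stage3Params} (lam : ResidB8 θ) (hD : 2 ≤ θ.D)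
    {B₀'H B₂' BG BR cL : ℝ} (hB₀'H : 0 < B₀'H) (hB₂' : 0 ≤ B₂') (hBG : 0 ≤ BG) (hBR : 0 ≤ BR) (hcL : 0 < cL)
    -- [4]'s letters AT THE `Ω₀ = ℤᵈ` LAW MEMBERS ONLY: existence side (laws on print's domains) and uniqueness side
    (SLet : ∀ i : ZdIdx θ.D θ.L, i.Ω 0 = Set.univ → IdxB8LawsB θ.L i → B8ConstraintBonds.DomainSeq θ.L i.Ω → (∀ l, l < i.k → ∀ z ∈ i.Λs i.k l, ((θ.L : ℤ) ^ l) • z ∈ B8ConstraintBonds.Lam θ.L i.Ω l) → SockLettersRD (𝔸 := θ.𝔸) θ.L BG BR B₀'H B₂' cL i.η i.k i.Ω i.Λs)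
    (SLetUB : ∀ i : ZdIdx θ.D θ.L, i.Ω 0 = Set.univ → IdxB8LawsB θ.L i → B8ConstraintBonds.DomainSeq θ.L i.Ω → (∀ l, l < i.k → ∀ z ∈ i.Λs i.k l, ((θ.L : ℤ) ^ l) • z ∈ B8ConstraintBonds.Lam θ.L i.Ω l) → ∀ α₀ : ℝ, 0 < α₀ → α₀ ≤ cL → ∀ U₀ : Site θ.D → Fin θ.D → θ.𝔸ˣ, (∀ x κ, U₀ x κ ∈ unitaryUnits θ.𝔸) →
      InAk θ.L i.k i.η α₀ i.Ω U₀ →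
      ∃ (g Δ : (Site θ.D → θ.𝔸) →ₗ[ℂ] (Site θ.D → θ.𝔸)) (q : (Site θ.D → θ.𝔸) →ₗ[ℂ] (ℕ → Site θ.D → θ.𝔸))
        (qs : (ℕ → Site θ.D → θ.𝔸) →ₗ[ℂ] (Site θ.D → θ.𝔸)) (Aw c : (ℕ → Site θ.D → θ.𝔸) →ₗ[ℂ] (ℕ → Site θ.D → θ.𝔸))
        (H' : XSpace θ.D i.k θ.𝔸 →ₗ[ℂ] (Site θ.D → θ.𝔸)),
        (∀ x : Site θ.D → θ.𝔸, (∃ C : ℝ, ∀ y, ‖x y‖ ≤ C) → g (Δ x + qs (Aw (q x))) = x) ∧ (∀ φ, qs (c (q (g (g (qs φ))))) = qs φ) ∧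
        (∀ (f : Site θ.D → θ.𝔸), ∀ x ∈ i.Ω 0, Δ f x = covLap i.η U₀ ((i.Ω 0).indicator f) x) ∧
        (∀ (μ : ℕ → Site θ.D → θ.𝔸), ∀ x ∈ i.Ω 0, qs μ x = QT θ.L i.k (i.Λs i.k) U₀ μ x) ∧
        (∀ (f : Site θ.D → θ.𝔸) (n : ℕ), n ≤ i.k → ∀ y ∈ i.Λs i.k n, q f n y = QprimeIter (zdBlocking θ.D θ.L) (bgT θ.L U₀) n f y) ∧
        (∀ (f : Site θ.D → θ.𝔸) (n : ℕ) (y : Site θ.D), ¬ (n ≤ i.k ∧ y ∈ i.Λs i.k n) → q f n y = 0) ∧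
        (∀ (X : XSpace θ.D i.k θ.𝔸) (x : Site θ.D), ‖H' X x‖ ≤ B₀'H * ‖X‖) ∧
        (∀ n, n ≤ i.k → ∀ (X : XSpace θ.D i.k θ.𝔸), ∀ p ∈ {b : Site θ.D × Fin θ.D | SideTouches (i.Ω n) b.1 b.2},
          wt θ.L i.η n * ‖covDerivFwd i.η U₀ p.2 (H' X) p.1‖ ≤ B₀'H * ‖X‖) ∧
        (∀ X : XSpace θ.D i.k θ.𝔸, Bd2 θ.L i.η i.k i.Ω (covLap i.η U₀ (H' X)) (B₂' * ‖X‖)) ∧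
        (∀ (Y : XSpace θ.D i.k θ.𝔸) (n : ℕ) (hn : n ≤ i.k) (y : Site θ.D), y ∈ i.Λs i.k n →
          QprimeIter (zdBlocking θ.D θ.L) (bgT θ.L U₀) n (H' Y) y = Y (⟨n, Nat.lt_succ_of_le hn⟩, y)) ∧
        (∀ (f : Site θ.D → θ.𝔸) (r : ℝ), 0 ≤ r → Bd2 θ.L i.η i.k i.Ω f r →
          (∀ x, ‖g f x‖ ≤ BG * r) ∧ ∀ n, n ≤ i.k → ∀ p ∈ {b : Site θ.D × Fin θ.D | SideTouches (i.Ω n) b.1 b.2},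
            wt θ.L i.η n * ‖covDerivFwd i.η U₀ p.2 (g f) p.1‖ ≤ BG * r) ∧
        (∀ (f : Site θ.D → θ.𝔸) (r : ℝ), 0 ≤ r → Bd2 θ.L i.η i.k i.Ω f r → Bd2 θ.L i.η i.k i.Ω (f - g (qs (c (q (g f))))) (BR * r)))
    {c59 cP3 γ₈ γ' γ'' γβ B₈ B₈β : ℝ} (hc59 : 0 < c59) (hcP3 : 0 < cP3) (hγ₈ : 1 ≤ γ₈) (hγ' : 0 ≤ γ') (hγ'' : 0 ≤ γ'')
    (hB : 2 ≤ 5 * (θ.D : ℝ) * θ.L * lam.inp.B₀) (hB₀β : 0 < lam.B₀β) (hB₀8 : lam.inp.B₀ ≤ B₈)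
    (hγB : 5 * (θ.D : ℝ) * θ.L * lam.inp.B₀ + 2 * (γ' * lam.inp.B₀) ≤ 5 * (θ.D : ℝ) * θ.L * B₈)
    (hγB'' : 5 * (θ.D : ℝ) * θ.L * lam.inp.B₀ + 2 * (γ'' * lam.inp.B₀) ≤ 5 * (θ.D : ℝ) * θ.L * B₈)
    (hB8β : 5 * (θ.D : ℝ) * θ.L * lam.B₀β + 2 * lam.B₀β * (γ'' * lam.inp.B₀) + γβ ≤ 5 * (θ.D : ℝ) * θ.L * B₈β)
    (hB₁eq : lam.B₁ = 5 * (θ.D : ℝ) * θ.L * B₈ * (1 + 11 * (θ.D : ℝ) ^ 2)) (hB₂eq : lam.B₂ = 5 * (θ.D : ℝ) * θ.L * B₈β * (1 + 11 * (θ.D : ℝ) ^ 2))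
    (hfreeS : 3 * (2 * (θ.D : ℝ) * (θ.L : ℝ) ^ 2) * BG * BR * (B₈ + γ₈) ≤ lam.inp.B₀' * B₈)
    -- [Balaban1985BackgroundPropagators] Thm 3.3 WITH SOURCE in Theorem 4's frame at (1.146), γ′ letter, threshold `c59`, at the law members ONLY — HYPOTHESIS
    (SH59src : ∀ i : ZdIdx θ.D θ.L, i.Ω 0 = Set.univ → IdxB8LawsB θ.L i → B8ConstraintBonds.DomainSeq θ.L i.Ω → (∀ l, l < i.k → ∀ z ∈ i.Λs i.k l, ((θ.L : ℤ) ^ l) • z ∈ B8ConstraintBonds.Lam θ.L i.Ω l) → ∀ α₀ α₁ : ℝ, 0 < α₀ → 0 < α₁ → α₀ + α₁ ≤ c59 →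
      ∀ U₀ U' : Site θ.D → Fin θ.D → θ.𝔸ˣ, (∀ x κ, U₀ x κ ∈ unitaryUnits θ.𝔸) → (∀ x κ, U' x κ ∈ unitaryUnits θ.𝔸) →
      ∀ φ : Site θ.D → θ.𝔸, ((InR138 θ.L i.k i.η (i.Ω 0) (i.Λs i.k) U₀ φ ∧ (∀ x, IsSelfAdjoint (φ x)) ∧ (∀ x, x ∉ i.Ω 0 → φ x = 0) ∧
          Bdd θ.L i.k i.η (-(2 : ℝ)) (fun j (x : Site θ.D) => x ∈ i.Ω j) φ) ∧
        msup θ.L i.k i.η (-(2 : ℝ)) (fun j (x : Site θ.D) => x ∈ i.Ω j) φ < γ₈ * (α₀ + α₁)) →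
      InAk θ.L i.k i.η α₀ i.Ω U₀ → InAk θ.L i.k i.η α₀ i.Ω (mulCfg U' U₀) → (∀ m, m ≤ i.k → InAx θ.L m (i.Λs m) U₀ (mulCfg U' U₀)) →
      (∀ j, j ≤ i.k → ∀ (z : Site θ.D) (μ : Fin θ.D),
        ((∀ x, InBox (tlo θ.L z j) (thi θ.L z j) x → x ∈ i.Ω j) ∨ (∀ x, InBox (tlo θ.L (z + e μ) j) (thi θ.L (z + e μ) j) x → x ∈ i.Ω j)) →
        ‖(avgIter θ.L (mulCfg U' U₀) j z μ : θ.𝔸) - (avgIter θ.L U₀ j z μ : θ.𝔸)‖ ≤ α₁) →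
      (∀ b ∈ {b : Site θ.D × Fin θ.D | SideTouches (i.Ω 0) b.1 b.2}, ‖((U' b.1 b.2 : θ.𝔸ˣ) : θ.𝔸) - 1‖ ≤ α₁) →
      (∀ m, 1 ≤ m → m ≤ i.k → ∀ (u : Site θ.D → θ.𝔸ˣ) (W : Site θ.D → Fin θ.D → θ.𝔸ˣ) (A' : Site θ.D → Fin θ.D → θ.𝔸),
        (∀ x, u x ∈ unitaryUnits θ.𝔸) → mgauge U₀ u W = U' → Restr129 θ.L m (i.Λs m) U₀ u → LanF146 θ.L i.k i.η (i.Ω 0) i.Λs U₀ φ m W →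
        (∀ y τ, IsSelfAdjoint (A' y τ)) →
        (∀ j, j ≤ m → ∀ y τ, SideTouches (i.Ω j) y τ →
        W y τ = cfgExp i.η A' y τ ∧ ‖A' y τ‖ ≤ (2 * (θ.L * (5 * (θ.D : ℝ) * θ.L * B₈ * (α₀ + α₁))) + 8 * (8 * lam.inp.B₀' * (5 * (θ.D : ℝ) * θ.L * B₈) * (α₀ + α₁))) * ((θ.L : ℝ) ^ j * i.η)⁻¹) →
        (∀ y τ, (∀ j, j ≤ m → ¬ SideTouches (i.Ω j) y τ) → A' y τ = 0) →
        msup θ.L m i.η (-(1 : ℝ)) (fun j (b : Site θ.D × Fin θ.D) => SideTouches (i.Ω j) b.1 b.2) (fun b => A' b.1 b.2)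
        ≤ lam.inp.B₀ * (bondNorm θ.L m i.η (-(3 : ℝ)) i.Ω (fun x μ => Jcur i.η U₀ A' μ x)
        + wsup 1 (fun p : {p : ℕ × (Site θ.D × Fin θ.D) // p.1 ≤ m ∧ p.2 ∈ towerBondsP θ.L i.Ω (i.Λs m) p.1} =>
        linCovIter θ.L U₀ (iEta i.η A') p.1.1 p.1.2.1 p.1.2.2)) + γ' * lam.inp.B₀ * (α₀ + α₁) ∧
        msup θ.L m i.η (-(2 : ℝ)) (fun j (t : Fin θ.D × Fin θ.D × Site θ.D) => SideTouches (i.Ω j) t.2.2 t.2.1)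
        (fun t => covDerivFwd i.η U₀ t.1 (fun z => A' z t.2.1) t.2.2)
        ≤ lam.inp.B₀ * (bondNorm θ.L m i.η (-(3 : ℝ)) i.Ω (fun x μ => Jcur i.η U₀ A' μ x)
        + wsup 1 (fun p : {p : ℕ × (Site θ.D × Fin θ.D) // p.1 ≤ m ∧ p.2 ∈ towerBondsP θ.L i.Ω (i.Λs m) p.1} =>
        linCovIter θ.L U₀ (iEta i.η A') p.1.1 p.1.2.1 p.1.2.2)) + γ' * lam.inp.B₀ * (α₀ + α₁)))
    -- THE SOURCED b9 SOCKET OF PROPOSITION 3's FRAME at the `Ω₀ = ℤᵈ` law members, threshold `cP3`, `|B₁|` over print's class at the top truncation — HYPOTHESIS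
    -- ([Balaban1985BackgroundPropagators] Thm 3.3 with source; = `B8Prop3SrcZd3HPGamma`'s input letter for letter)
    (SB9srcHP : ∀ i : ZdIdx θ.D θ.L, i.Ω 0 = Set.univ → IdxB8LawsB θ.L i → B8ConstraintBonds.DomainSeq θ.L i.Ω → (∀ l, l < i.k → ∀ z ∈ i.Λs i.k l, ((θ.L : ℤ) ^ l) • z ∈ B8ConstraintBonds.Lam θ.L i.Ω l) → ∀ α₀ α₁ α₂ : ℝ, 0 < α₀ → α₀ ≤ cP3 → 0 < α₁ → 0 < α₂ → α₂ ≤ cP3 →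
      ∀ (U₀ W : Site θ.D → Fin θ.D → θ.𝔸ˣ), (∀ x κ, U₀ x κ ∈ unitaryUnits θ.𝔸) → (∀ x κ, W x κ ∈ unitaryUnits θ.𝔸) →
      ∀ f : Site θ.D → θ.𝔸, InR138 θ.L i.k i.η (i.Ω 0) (i.Λs i.k) U₀ f →
      (∀ x, IsSelfAdjoint (f x)) → (∀ x, x ∉ i.Ω 0 → f x = 0) →
      Bdd θ.L i.k i.η (-(2 : ℝ)) (fun j (x : Site θ.D) => x ∈ i.Ω j) f →
      msup θ.L i.k i.η (-(2 : ℝ)) (fun j (x : Site θ.D) => x ∈ i.Ω j) f < γ₈ * (α₀ + α₁) →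
      msup θ.L i.k i.η (-(3 : ℝ)) (fun j (p : Fin θ.D × Site θ.D) => p.2 ∈ i.Ω j) (fun p => covDerivFwd i.η U₀ p.1 f p.2) < γ₈ * (α₀ + α₁) →
      InAk θ.L i.k i.η α₀ i.Ω U₀ → InAk θ.L i.k i.η α₀ i.Ω (mulCfg W U₀) → IsLandau146W θ.L i.k i.η (i.Ω 0) (i.Λs i.k) U₀ f W →
      ∀ A' : Site θ.D → Fin θ.D → θ.𝔸, (∀ y τ, IsSelfAdjoint (A' y τ)) →
      (∀ j, j ≤ i.k → ∀ (y : Site θ.D) (τ : Fin θ.D), SideTouches (i.Ω j) y τ →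
        W y τ = cfgExp i.η A' y τ ∧ ‖A' y τ‖ ≤ α₂ * ((θ.L : ℝ) ^ j * i.η)⁻¹) →
      (∀ (y : Site θ.D) (τ : Fin θ.D), (∀ j, j ≤ i.k → ¬ SideTouches (i.Ω j) y τ) → A' y τ = 0) →
      msup θ.L i.k i.η (-(1 : ℝ)) (fun j (b : Site θ.D × Fin θ.D) => SideTouches (i.Ω j) b.1 b.2) (fun b => A' b.1 b.2)
          ≤ lam.inp.B₀ * (bondNorm θ.L i.k i.η (-(3 : ℝ)) i.Ω (fun x μ => Jcur i.η U₀ A' μ x)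
            + wsup 1 (fun p : {p : ℕ × (Site θ.D × Fin θ.D) // p.1 ≤ i.k ∧ p.2 ∈ towerBondsP θ.L i.Ω (i.Λs i.k) p.1} =>
                linCovIter θ.L U₀ (iEta i.η A') p.1.1 p.1.2.1 p.1.2.2)) + γ'' * lam.inp.B₀ * (α₀ + α₁) ∧
        msup θ.L i.k i.η (-(2 : ℝ)) (fun j (t : Fin θ.D × Fin θ.D × Site θ.D) => SideTouches (i.Ω j) t.2.2 t.2.1)
            (fun t => covDerivFwd i.η U₀ t.1 (fun z => A' z t.2.1) t.2.2)
          ≤ lam.inp.B₀ * (bondNorm θ.L i.k i.η (-(3 : ℝ)) i.Ω (fun x μ => Jcur i.η U₀ A' μ x)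
            + wsup 1 (fun p : {p : ℕ × (Site θ.D × Fin θ.D) // p.1 ≤ i.k ∧ p.2 ∈ towerBondsP θ.L i.Ω (i.Λs i.k) p.1} =>
                linCovIter θ.L U₀ (iEta i.η A') p.1.1 p.1.2.1 p.1.2.2)) + γ'' * lam.inp.B₀ * (α₀ + α₁) ∧
        bondNorm θ.L i.k i.η (-(3 : ℝ)) i.Ω (fun x μ => pdiv i.η U₀ (plaqCovDeriv i.η U₀ A') μ x)
          ≤ lam.inp.B₀ * (bondNorm θ.L i.k i.η (-(3 : ℝ)) i.Ω (fun x μ => Jcur i.η U₀ A' μ x)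
            + wsup 1 (fun p : {p : ℕ × (Site θ.D × Fin θ.D) // p.1 ≤ i.k ∧ p.2 ∈ towerBondsP θ.L i.Ω (i.Λs i.k) p.1} =>
                linCovIter θ.L U₀ (iEta i.η A') p.1.1 p.1.2.1 p.1.2.2)) + γ'' * lam.inp.B₀ * (α₀ + α₁) ∧
        bondNorm θ.L i.k i.η (-(3 : ℝ)) i.Ω (fun x μ => covLap i.η U₀ (fun z => A' z μ) x)
          ≤ lam.inp.B₀ * (bondNorm θ.L i.k i.η (-(3 : ℝ)) i.Ω (fun x μ => Jcur i.η U₀ A' μ x)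
            + wsup 1 (fun p : {p : ℕ × (Site θ.D × Fin θ.D) // p.1 ≤ i.k ∧ p.2 ∈ towerBondsP θ.L i.Ω (i.Λs i.k) p.1} =>
                linCovIter θ.L U₀ (iEta i.η A') p.1.1 p.1.2.1 p.1.2.2)) + γ'' * lam.inp.B₀ * (α₀ + α₁) ∧
        msup θ.L i.k i.η (-(2 + lam.β)) (fun j (q : Fin θ.D × Fin θ.D × (Site θ.D × Site θ.D)) => q.2.2 ∈ AdmPair i.η lam.len ∧ q.2.2.1 ∈ i.Ω j ∧ q.2.2.2 ∈ i.Ω j)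
            (fun q => hquot i.η lam.β lam.len U₀ (covDerivFwd i.η U₀ q.1 (fun z => A' z q.2.1)) q.2.2)
          ≤ lam.B₀β * (bondNorm θ.L i.k i.η (-(3 : ℝ)) i.Ω (fun x μ => Jcur i.η U₀ A' μ x)
            + wsup 1 (fun p : {p : ℕ × (Site θ.D × Fin θ.D) // p.1 ≤ i.k ∧ p.2 ∈ towerBondsP θ.L i.Ω (i.Λs i.k) p.1} =>
                linCovIter θ.L U₀ (iEta i.η A') p.1.1 p.1.2.1 p.1.2.2)) + γβ * (α₀ + α₁)) :
    B8Thm8Surviving.Thm8SurvivingAt 1 lam.B₁ lam.B₂ (fun j : IdxB8SubD θ => zdGF3HP₂ θ.𝔸 θ.L lam.β lam.len j.1.1.1.1) := by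
  -- constants: `0 < B₀ ≤ B₈`, `2 ≤ 5dLB₀ ≤ 5dLB₈`, `0 ≤ γ₈`, `2γ′B₀ ≤ 5dLB₈`
  have hB₀ : 0 < lam.inp.B₀ := lam.inp.B₀_pos
  have hB₈ : 0 < B₈ := lt_of_lt_of_le hB₀ hB₀8
  have h5 : 0 ≤ 5 * (θ.D : ℝ) * θ.L := by positivity
  have hB8' : 2 ≤ 5 * (θ.D : ℝ) * θ.L * B₈ := hB.trans (mul_le_mul_of_nonneg_left hB₀8 h5)
  have hγ₈0 : 0 ≤ γ₈ := zero_le_one.trans hγ₈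
  have hγB2 : 2 * (γ' * lam.inp.B₀) ≤ 5 * (θ.D : ℝ) * θ.L * B₈ :=
    le_trans (le_add_of_nonneg_left (mul_nonneg h5 hB₀.le)) hγB
  -- PROPOSITION 5 ∃∕! WITH SOURCE in the γ′ letters: the three sourced sockets below member-UNIFORM thresholds (dag-n05-w4)
  obtain ⟨cP5, hcP5, H5⟩ := exists_uniform_threshold_sp5_src_γ' (𝔸 := θ.𝔸) (γ := γ₈) hD θ.two_le_L hB8' hfreeS hcL hB₀ lam.inp.B₀'_pos hB₀'H hB₂' hBG
    hBR hγ₈0 hγ' hB₀8 hγB2 hc59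
  obtain ⟨cPb, hcPb, Hb⟩ := exists_uniform_threshold_sp5base_src_γ' (𝔸 := θ.𝔸) (γ := γ₈) hD θ.two_le_L hfreeS hcL lam.inp.B₀'_pos hB₀'H hB₂' hBG hBR hγ₈0
    hB₈ hB8'
  obtain ⟨cu, cPu, hcu, hcPu, Hu⟩ := exists_uniform_threshold_sp5u_src_γ' (𝔸 := θ.𝔸) (γ := γ₈) hD θ.two_le_L hB8' hcL hB₀ lam.inp.B₀'_pos hB₀'H hB₂' hBG hBR
    hγ₈0 hγ' hB₀8 hγB2 hc59
  -- ONE threshold for Theorem 8's four Prop-5-type sockets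
  have hcP : 0 < min c59 (min cPb (min cP5 cPu)) := lt_min hc59 (lt_min hcPb (lt_min hcP5 hcPu))
  have hP59 : min c59 (min cPb (min cP5 cPu)) ≤ c59 := min_le_left _ _
  have hPb : min c59 (min cPb (min cP5 cPu)) ≤ cPb := (min_le_right _ _).trans (min_le_left _ _)
  have hP5 : min c59 (min cPb (min cP5 cPu)) ≤ cP5 := (min_le_right _ _).trans ((min_le_right _ _).trans (min_le_left _ _))
  have hPu : min c59 (min cPb (min cP5 cPu)) ≤ cPu := (min_le_right _ _).trans ((min_le_right _ _).trans (min_le_right _ _))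
  -- the sockets-displayed theorem at the served sockets (print's class: box law and trichotomy by `ZdIdx.towerBondsP_laws`; tower law from №-laws)
  exact t8P₂D_of_socketsSrc_γ' lam hD hcP hcu hcP3 hγ₈ hγ' hγ'' hB hB₀β hB₀8 hγB hγB'' hB8β hB₁eq hB₂eq
    (fun i hΩ hl hds hlt α₀ α₁ hα₀ hα₁ hs => Hb i.η i.k i.Ω i.Λs (fun m j => towerBondsP θ.L i.Ω (i.Λs m) j) i.hη i.hk i.hΩ
      hl.toIdxB8Laws.tower_all (SLet i hΩ hl hds hlt) α₀ α₁ hα₀ hα₁ (hs.trans hPb))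
    (fun i hΩ hl hds hlt α₀ α₁ hα₀ hα₁ hs => H5 i.η i.k i.Ω i.Λs (fun m j => towerBondsP θ.L i.Ω (i.Λs m) j) i.hη i.hΩ
      (B8TowerBondsPrinted.ZdIdx.towerBondsP_laws i).1 (B8TowerBondsPrinted.ZdIdx.towerBondsP_laws i).2 hl.toIdxB8Laws.tower_all
      hl.trunc_lt hl.trunc_top (SLet i hΩ hl hds hlt) (SH59src i hΩ hl hds hlt) α₀ α₁ hα₀ hα₁ (hs.trans hP5))
    (fun i hΩ hl hds hlt α₀ α₁ hα₀ hα₁ hs => SH59src i hΩ hl hds hlt α₀ α₁ hα₀ hα₁ (hs.trans hP59))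
    (fun i hΩ hl hds hlt α₀ α₁ hα₀ hα₁ hs => Hu i.η i.k i.Ω i.Λs (fun m j => towerBondsP θ.L i.Ω (i.Λs m) j) i.hη i.hk i.hΩ hΩ
      (B8TowerBondsPrinted.ZdIdx.towerBondsP_laws i).1 (B8TowerBondsPrinted.ZdIdx.towerBondsP_laws i).2 i.htower
      (SLetUB i hΩ hl hds hlt) (SH59src i hΩ hl hds hlt) α₀ α₁ hα₀ hα₁ (hs.trans hPu))
    SB9srcHP

end T8P


end Summit.QuantumFields.YangMills.BalabanUVNodes.N05SubBP2DT8SrvGammaPrime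

end
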